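import Summits.BirchSwinnertonDyer.Rank1Residual.X4.KolyvaginIndexRecordsKitOddPrime
import HarnessLib

/-!
# BSD rank-≤1 residual cell, lane class X11b (`p ∥ N`: MULTIPLICATIVE at a prime `p ≥ 5`, `ρ̄_{E,p}` irreducible),
rank ONE: `BSD(E,p)` PER PAIR from
# PUBLISHED theorems + Kolyvagin's HEEGNER-INDEX certificate (two engines), `ρ̄_{E,p}` onto IN THE KERNEL — records 63

HONEST FRAMING (cell `b2b-bsdres-*`, verbatim): prove what is provable now; shrink each hard class to its core with
data; no claim beyond stated classes; COMBINATION classes deleted from PUBLISHED theorems only, CONSTRUCTION-shaped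
remainder typed; this is not "finishing BSD". X11b stays CONSTRUCTION-SHAPED; everything here is PER PAIR; no lane
verdict is changed; no named fact is introduced (debt 0); nothing is booked by this unit (the rung-K2 owner
bsd-stepL, the x11b
lineage that holds row B9's E1/K2 claim, census-lead, the Kurihara lane and referee A decide what a record is
worth); Cremona's numbers
(`r_an = 1`, `#Ш_an`, models, generators, `∏ c_ℓ`, torsion, optimality / Manin codes, the galrep datum) are INPUTS.

Unit `b2b-bsdres-x11c`, GEN 32 (prover-b2b-bsdres-x11c-g32-0) — the «X11 beyond 3» half of the unit's D-0075 purpose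
(«GRH-free
Kolyvagin–Heegner-index certificates X4 r1 p ≥ 7, X11 beyond 3»): the cell's certificate engines turned on lane
class X11b as GEN 27–31 turned
them on X7 (`Supersingular/KolyvaginIndexRecordsX7RankOne01–432`). POPULATION
(`HOME/b2b-bsdres-x11c/gen32/pop/build_harvest_x11b.py` = gen 27's
class-agnostic census restricted to X11b with a per-(label, p) record test): the rank-ONE classes (Cremona curve 1,
non-CM) whose cell
`(p, X11b)` — `p ≥ 5`, `p ∥ N` — is OPEN on the Kurihara lane's residue of record (bsdN sweep v4u `RESIDUE.jsonl` ×
v5u verdict `residue`; on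
848 of them the lane's own tail is T-KOLY, whose single certified Heegner field excludes the primes dividing
`m·D_K`) and which are
certificate-shaped on Cremona's data — no galrep code at `p` (`ρ̄_{E,p}` onto), `p ∤ #E(ℚ)_tors·∏ c_ℓ` (so
`p ∤ c_p = ord_p Δ` at a split
`p`), `p ∤ #Ш_an` — and carry no Kolyvagin-index record `bsdp_k<label>_<p>`: 927 pairs on 869 classes (`p = 5`: 605,
`7`: 221, `11`: 41,
`13`: 20, `17 ≤ p ≤ 103`: 40; split 411 / non-split 516; 268 semistable; `1.6·10⁴ < N < 5·10⁵`). 920 of them ALSO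
carry the unit's GEN 10
beyond-window DATA record (`X11b/BeyondWindowRecordsNN`: Skinner 2016 Thm. A ∘ Stein–Wuthrich 2013 `p`-adic road,
binders as displayed there)
— for those this file is a SECOND, GRH-free and main-conjecture-free road; 7 carry no per-pair record. Not in reach
of this route (numbers, not
a verdict): the lane's 3 062 Tamagawa-obstructed X11b rank-one cells at `p ≥ 5` (`p ∣ c_q` for some `q`; Jetchev
2008's Hypothesis (∗)
`p ∤ N` fails at `p ∥ N`). THIS FILE (records 63): 10 pairs — `125580t1@7`, `127050fk1@7`, `127050ib1@7`,
`130620e1@7`, `131670bj1@7`, `131670z1@7`, `139230de1@7`, `140910bf1@7`, `149226bv1@7`, `150150cg1@7`. 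

THE ROUTE (the unit's GEN 26/27 Kolyvagin route, class-agnostic): Kolyvagin's theorem as PRINTED by McCallum (LMS LN
153 (1991) §1, p. 296) /
Gross (ibid., Prop. 2.1 (2)) — tree named facts `kolyvagin`, `Kolyvagin1990_padicValNat_card_sha_le`, whose printed
hypotheses are `y_K` of
infinite order, `p` odd, `ρ̄_{E,p}` onto, and NOTHING about the reduction of `E` at `p` (at `p ∥ N` the Heegner
hypothesis — every prime of
`N` split in `K` — makes `p` split in `K`; nothing more is asked) —: `ord_p #Ш(E/K) ≤ 2·ord_p [E(K):ℤy_K]`; so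
`p ∤ [E(K):ℤy_K]` gives
`Ш(E/K)[p] = 0`, hence `Ш(E/ℚ)[p] = 0`, and with `ord_p #Ш_an = 0` Miller's `BSD(E,p)` — the tree's class-agnostic
consumer
`Typed.bsdp_of_kolyvagin_of_not_dvd_index` (`Literature/…/Rank1Residual/Typed/KolyvaginCertificate.lean`).

THE CERTIFICATE (per pair; the cell's EXISTING engines run VERBATIM — no private engine, no knob; ONE batched kit
job per stage with an
in-job fan-out wrapper): engine 1 = gen 3's `engine1_cha1b/main.py` = x9-g7 `jobD1b.py` (cypari2, sha256
`69e29ec7…`; rank-one mode: Heegner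
fields `K = ℚ(√D)`, `D < -4` fundamental, every prime of `N` split, `p ∤ D`, increasing `|D| ≤ 6000`, `≤ 30` fields;
root number of `E^D`
`+1`, rank-`≥ 2` twists skipped; `hy = L'(E,1)·L(E^D,1)·√|D|/(4·Area(E))`, `ρ = hy/ĥ(x)`, `m = √(4ρ)` an integer,
CERT iff `p ∤ m` —
Miller 2011 Thm. 4.1 / Cor. 4.8); engine 2 = gen 3's `engine2/run_cert.py` (`1b54bb20…`) + `e2lib.py` (`6701e05d…`)
+ `tate_stdlib.py`
(`ed9e5fd9…`) (stdlib python: independent `L`-series, AGM periods, Tate heights; `m`, `ord_p m` must be EQUAL;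
discrete checks — model,
conductor, Tamagawa, non-CM, irreducibility / saturation / `E(K)[p] = 0` witnesses, `D` Heegner); twist values =
additive-p1's
`twistvals/main.py` (`e501b988…`). Kit jobs: j259809, j260660, j260662, j260664, j260666, j260667. Evidence:
`HOME/b2b-bsdres-x11c/gen32/` (`KOLY-X11BR1-TABLE.md`, outputs, inputs,
SHA256SUMS); REPORT.md §41.

KERNEL (per pair, through the unit's kit theorem `X4.bsdp_prime_of_kolyvaginIndex_of_serreCounts` of
`X4/KolyvaginIndexRecordsKitOddPrime.lean` — class-agnostic despite its namespace —, every numeric hypothesis a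
`decide` goal): `Δ ≠ 0`;
global minimality of Cremona's model (bounded Kraus criterion); `ρ̄_{E,p}` ONTO by Serre's Prop. 19 from three
witness primes
`(ℓ₁, ℓ₂, ℓ₃)` (types s₁ split / s₂ non-split / s₃ `u = a²/ℓ ∉ {0,1,2,4}`, `u² − 3u + 1 ≢ 0`) whose point counts
`#Ẽ(𝔽_ℓ)` (schema
`countPoints`) are evaluated in the kernel. BINDERS (displayed in every theorem): `hGZK` (Gross–Zagier–Kolyvagin),
`hKo` / `hB` (Kolyvagin
as printed), the Heegner datum (`K`, level `N`, `P`, `p ∤ [E(K):ℤP]`), `r_an ≤ 1`, `#Ш_an = q` with `ord_p q = 0`.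
NOT rechecked in the
kernel (engine work): `L'(E,1)`, `L(E^D,1)`, periods, heights, saturation, the integrality of `4ρ`; nor the lane's
class bit (`p ∥ N`,
split / non-split — bookkeeping only, the route does not use it). What a record is worth is the owners' / lane's /
referee's call
(EVIDENCE-grade certificate under displayed binders, as every Heegner-index record of the cell).

References: McCallum 1991 §1 [McCallumLMS1991]; Gross 1991 Prop. 2.1 [GrossLMS1991]; Kolyvagin 1990
[KolyvaginEulerSystems1990]; Serre 1972 §2.8 Prop. 19 [Serre1972]; Miller 2011 Def. 1.1, Thm. 4.1, Cor. 4.8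
[Miller2011LMS];
Silverman AEC VII.1, VIII.8 [SilvermanAEC2009]; Cremona's tables [Cremona2006].
-/

set_option autoImplicit false

noncomputable section

open scoped Classical

open WeierstrassCurve Literature.NumberTheory.EllipticCurves
  Literature.NumberTheory.EllipticCurves.Rank1Residual
  Literature.NumberTheory.EllipticCurves.Rank1Residual.Typed
  Literature.NumberTheory.EllipticCurves.Rank1Residual.X11RankOneCertificates
  Summit.BirchSwinnertonDyer.BirchSwinnertonDyer.Rank1Residual.IntModel
  Summit.BirchSwinnertonDyer.BirchSwinnertonDyer.Rank1Residual.X11RankOne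
  Summit.BirchSwinnertonDyer.Rank1Residual.X4

namespace Summit.BirchSwinnertonDyer.Rank1Residual.X11b

/-- **`BSD(E,7)` for `125580t1`** (`N = 125580 = 2²·3·5·7·13·23`; SPLIT MULTIPLICATIVE at `7` (Kodaira `I1`, `c_7 = 1`, additive at `2`); `#tors = 2`,
`∏c = 12`, `r_an = 1`, `#Ш_an = 1`, generator `(2689/9, 43415/27)`; lane residue cell `(7, X11b)` (bsdN v4u/v5u of record: `residue:X11b`, lane tail
T-KOLY); ALSO the unit's GEN 10 beyond-window DATA record in `X11b/BeyondWindowRecords14.lean` (Skinner 2016 Thm. A ∘ Stein–Wuthrich 2013 `p`-adic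
road, binders as displayed there) — this row is a SECOND road). `D = -3839` (3839 = 11·349): **`m = [E(K):ℤy_K] = 36`, `7 ∤ m`** (`ρ = 324.00…`;
`L'(E,1) = 8.47201165…`, `L(E^D,1) = 0.33711661…`, `ĥ(x) = 7.18000759…`) — engine 1 (j259809) = engine 2 (j260664; EQUAL, dev. ≤ 1.1·10⁻¹³, checks
true); twist `E^D` (j260667): `#tors·∏c·#Ш_an = 2·48·9`, prime to `7` — BSD-consistent. Witnesses mod `7` `(ℓ,#Ẽ(𝔽_ℓ))` = `(11,10)` (`a = 2`,
`a² − 4ℓ ≡ 2` square), `(19,16)` (`a = 4`, `a² − 4ℓ ≡ 3` non-square), `(17,22)` (`u ≡ 3`).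
[cite: McCallumLMS1991, §1 Theorem (Kolyvagin), p. 296] [cite: Serre1972, §2.8 Prop. 19] [cite: Cremona2006, Table 1 (label 125580t1)] -/
theorem bsdp_k125580t1_7 (hGZK : rank_eq_analyticRank_of_analyticRank_le_one) (W : WeierstrassCurve ℚ)
    (hW : W = ⟨0, 1, 0, -371561, 86839104⟩) {N : ℕ} [NeZero N] {K : Type} [Field K] [NumberField K]
    (hKo : kolyvagin N W K) (hB : Kolyvagin1990_padicValNat_card_sha_le N W K) (hK : IsImaginaryQuadratic K)
    (hH : SatisfiesHeegnerHypothesis N K) {P : (W.baseChange K).toAffine.Point} (hP : IsHeegnerPoint N W K P)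
    (hnt : ¬ IsOfFinAddOrder P) (hI : ¬ 7 ∣ (AddSubgroup.zmultiples P).index) (hr : W.analyticRank ≤ 1)
    {q : ℚ} (hq : shaAn W = (q : ℂ)) (hv : padicValRat 7 q = 0) : BSDp W 7 :=
  bsdp_prime_of_kolyvaginIndex_of_serreCounts 7 (by norm_num) (by norm_num) 0 1 0 (-371561) 86839104 (by decide +kernel)
    (by decide +kernel) (by decide +kernel) 11 19 17 (by norm_num) (by norm_num) (by norm_num) (by norm_num)
    (by norm_num) (by norm_num) (by norm_num) (by norm_num) (by norm_num) (by decide +kernel) (by decide +kernel)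
    (by decide +kernel) (n₁ := 10) (n₂ := 16) (n₃ := 22) (hc₁ := by decide +kernel) (hc₂ := by decide +kernel)
    (hc₃ := by decide +kernel) (by decide +kernel) (by decide +kernel) (by decide +kernel) hGZK W
    (by rw [hW]; norm_num) hKo hB hK hH hP hnt hI hr hq hv

/-- **`BSD(E,7)` for `127050fk1`** (`N = 127050 = 2·3·5²·7·11²`; NON-SPLIT MULTIPLICATIVE at `7` (Kodaira `I3`, `c_7 = 1`, additive at `5`, `11`);
`#tors = 1`, `∏c = 3`, `r_an = 1`, `#Ш_an = 1`, generator `(211/4, -171/8)`; lane residue cell `(7, X11b)` (bsdN v4u/v5u of record: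
`residue:X11b,X2`, lane tail T-KOLY, other open cells `(3, X2)`); ALSO the unit's GEN 10 beyond-window DATA record in
`X11b/BeyondWindowRecords14.lean` (Skinner 2016 Thm. A ∘ Stein–Wuthrich 2013 `p`-adic road, binders as displayed there) — this row is a SECOND
road). `D = -1559` (1559 prime): **`m = [E(K):ℤy_K] = 18`, `7 ∤ m`** (`ρ = 81.00…`; `L'(E,1) = 8.51598989…`, `L(E^D,1) = 0.33967375…`,
`ĥ(x) = 2.22584537…`) — engine 1 (j259809) = engine 2 (j260664; EQUAL, dev. ≤ 2.0·10⁻¹⁴, checks true); twist `E^D` (j260667):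
`#tors·∏c·#Ш_an = 1·6·9`, prime to `7` — BSD-consistent. Witnesses mod `7` `(ℓ,#Ẽ(𝔽_ℓ))` = `(13,16)` (`a = -2`, `a² − 4ℓ ≡ 1` square), `(19,18)`
(`a = 2`, `a² − 4ℓ ≡ 5` non-square), `(13,16)` (`u ≡ 3`).
[cite: McCallumLMS1991, §1 Theorem (Kolyvagin), p. 296] [cite: Serre1972, §2.8 Prop. 19] [cite: Cremona2006, Table 1 (label 127050fk1)] -/
theorem bsdp_k127050fk1_7 (hGZK : rank_eq_analyticRank_of_analyticRank_le_one) (W : WeierstrassCurve ℚ)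
    (hW : W = ⟨1, 1, 1, -8533, 299861⟩) {N : ℕ} [NeZero N] {K : Type} [Field K] [NumberField K]
    (hKo : kolyvagin N W K) (hB : Kolyvagin1990_padicValNat_card_sha_le N W K) (hK : IsImaginaryQuadratic K)
    (hH : SatisfiesHeegnerHypothesis N K) {P : (W.baseChange K).toAffine.Point} (hP : IsHeegnerPoint N W K P)
    (hnt : ¬ IsOfFinAddOrder P) (hI : ¬ 7 ∣ (AddSubgroup.zmultiples P).index) (hr : W.analyticRank ≤ 1)
    {q : ℚ} (hq : shaAn W = (q : ℂ)) (hv : padicValRat 7 q = 0) : BSDp W 7 :=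
  bsdp_prime_of_kolyvaginIndex_of_serreCounts 7 (by norm_num) (by norm_num) 1 1 1 (-8533) 299861 (by decide +kernel)
    (by decide +kernel) (by decide +kernel) 13 19 13 (by norm_num) (by norm_num) (by norm_num) (by norm_num)
    (by norm_num) (by norm_num) (by norm_num) (by norm_num) (by norm_num) (by decide +kernel) (by decide +kernel)
    (by decide +kernel) (n₁ := 16) (n₂ := 18) (n₃ := 16) (hc₁ := by decide +kernel) (hc₂ := by decide +kernel)
    (hc₃ := by decide +kernel) (by decide +kernel) (by decide +kernel) (by decide +kernel) hGZK W
    (by rw [hW]; norm_num) hKo hB hK hH hP hnt hI hr hq hv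

/-- **`BSD(E,7)` for `127050ib1`** (`N = 127050 = 2·3·5²·7·11²`; SPLIT MULTIPLICATIVE at `7` (Kodaira `I1`, `c_7 = 1`, additive at `5`, `11`);
`#tors = 1`, `∏c = 2`, `r_an = 1`, `#Ш_an = 1`, generator Cremona's (20-digit numerator); lane residue cell `(7, X11b)` (bsdN v4u/v5u of record:
`residue:X11b`, lane tail T-KOLY); ALSO the unit's GEN 10 beyond-window DATA record in `X11b/BeyondWindowRecords14.lean` (Skinner 2016 Thm. A ∘
Stein–Wuthrich 2013 `p`-adic road, binders as displayed there) — this row is a SECOND road). `D = -1559` (1559 prime): **`m = [E(K):ℤy_K] = 8`,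
`7 ∤ m`** (`ρ = 16.00…`; `L'(E,1) = 14.64724423…`, `L(E^D,1) = 0.10139476…`, `ĥ(x) = 43.69288268…`) — engine 1 (j259809) = engine 2 (j260664; EQUAL,
dev. ≤ 1.2·10⁻¹⁴, checks true); twist `E^D` (j260667): `#tors·∏c·#Ш_an = 1·4·4`, prime to `7` — BSD-consistent. Witnesses mod `7` `(ℓ,#Ẽ(𝔽_ℓ))` =
`(37,42)` (`a = -4`, `a² − 4ℓ ≡ 1` square), `(13,11)` (`a = 3`, `a² − 4ℓ ≡ 6` non-square), `(13,11)` (`u ≡ 5`).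
[cite: McCallumLMS1991, §1 Theorem (Kolyvagin), p. 296] [cite: Serre1972, §2.8 Prop. 19] [cite: Cremona2006, Table 1 (label 127050ib1)] -/
theorem bsdp_k127050ib1_7 (hGZK : rank_eq_analyticRank_of_analyticRank_le_one) (W : WeierstrassCurve ℚ)
    (hW : W = ⟨1, 0, 0, 42287, -13864333⟩) {N : ℕ} [NeZero N] {K : Type} [Field K] [NumberField K]
    (hKo : kolyvagin N W K) (hB : Kolyvagin1990_padicValNat_card_sha_le N W K) (hK : IsImaginaryQuadratic K)
    (hH : SatisfiesHeegnerHypothesis N K) {P : (W.baseChange K).toAffine.Point} (hP : IsHeegnerPoint N W K P)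
    (hnt : ¬ IsOfFinAddOrder P) (hI : ¬ 7 ∣ (AddSubgroup.zmultiples P).index) (hr : W.analyticRank ≤ 1)
    {q : ℚ} (hq : shaAn W = (q : ℂ)) (hv : padicValRat 7 q = 0) : BSDp W 7 :=
  bsdp_prime_of_kolyvaginIndex_of_serreCounts 7 (by norm_num) (by norm_num) 1 0 0 42287 (-13864333) (by decide +kernel)
    (by decide +kernel) (by decide +kernel) 37 13 13 (by norm_num) (by norm_num) (by norm_num) (by norm_num)
    (by norm_num) (by norm_num) (by norm_num) (by norm_num) (by norm_num) (by decide +kernel) (by decide +kernel)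
    (by decide +kernel) (n₁ := 42) (n₂ := 11) (n₃ := 11) (hc₁ := by decide +kernel) (hc₂ := by decide +kernel)
    (hc₃ := by decide +kernel) (by decide +kernel) (by decide +kernel) (by decide +kernel) hGZK W
    (by rw [hW]; norm_num) hKo hB hK hH hP hnt hI hr hq hv

/-- **`BSD(E,7)` for `130620e1`** (`N = 130620 = 2²·3·5·7·311`; SPLIT MULTIPLICATIVE at `7` (Kodaira `I1`, `c_7 = 1`, additive at `2`); `#tors = 2`,
`∏c = 4`, `r_an = 1`, `#Ш_an = 1`, generator `(190/49, 16400/343)`; lane residue cell `(7, X11b)` (bsdN v4u/v5u of record: `residue:X11b`, lane tail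
T-KOLY); ALSO the unit's GEN 10 beyond-window DATA record in `X11b/BeyondWindowRecords14.lean` (Skinner 2016 Thm. A ∘ Stein–Wuthrich 2013 `p`-adic
road, binders as displayed there) — this row is a SECOND road). `D = -1679` (1679 = 23·73): **`m = [E(K):ℤy_K] = 4`, `7 ∤ m`** (`ρ = 4.00…`;
`L'(E,1) = 6.47494623…`, `L(E^D,1) = 0.08492417…`, `ĥ(x) = 6.57317540…`) — engine 1 (j259809) = engine 2 (j260666; EQUAL, dev. ≤ 1.2·10⁻¹³, checks
true); twist `E^D` (j260667): `#tors·∏c·#Ш_an = 2·16·1`, prime to `7` — BSD-consistent. Witnesses mod `7` `(ℓ,#Ẽ(𝔽_ℓ))` = `(19,28)` (`a = -8`,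
`a² − 4ℓ ≡ 2` square), `(13,10)` (`a = 4`, `a² − 4ℓ ≡ 6` non-square), `(13,10)` (`u ≡ 5`).
[cite: McCallumLMS1991, §1 Theorem (Kolyvagin), p. 296] [cite: Serre1972, §2.8 Prop. 19] [cite: Cremona2006, Table 1 (label 130620e1)] -/
theorem bsdp_k130620e1_7 (hGZK : rank_eq_analyticRank_of_analyticRank_le_one) (W : WeierstrassCurve ℚ)
    (hW : W = ⟨0, -1, 0, -1085, 6450⟩) {N : ℕ} [NeZero N] {K : Type} [Field K] [NumberField K]
    (hKo : kolyvagin N W K) (hB : Kolyvagin1990_padicValNat_card_sha_le N W K) (hK : IsImaginaryQuadratic K)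
    (hH : SatisfiesHeegnerHypothesis N K) {P : (W.baseChange K).toAffine.Point} (hP : IsHeegnerPoint N W K P)
    (hnt : ¬ IsOfFinAddOrder P) (hI : ¬ 7 ∣ (AddSubgroup.zmultiples P).index) (hr : W.analyticRank ≤ 1)
    {q : ℚ} (hq : shaAn W = (q : ℂ)) (hv : padicValRat 7 q = 0) : BSDp W 7 :=
  bsdp_prime_of_kolyvaginIndex_of_serreCounts 7 (by norm_num) (by norm_num) 0 (-1) 0 (-1085) 6450 (by decide +kernel)
    (by decide +kernel) (by decide +kernel) 19 13 13 (by norm_num) (by norm_num) (by norm_num) (by norm_num)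
    (by norm_num) (by norm_num) (by norm_num) (by norm_num) (by norm_num) (by decide +kernel) (by decide +kernel)
    (by decide +kernel) (n₁ := 28) (n₂ := 10) (n₃ := 10) (hc₁ := by decide +kernel) (hc₂ := by decide +kernel)
    (hc₃ := by decide +kernel) (by decide +kernel) (by decide +kernel) (by decide +kernel) hGZK W
    (by rw [hW]; norm_num) hKo hB hK hH hP hnt hI hr hq hv

/-- **`BSD(E,7)` for `131670bj1`** (`N = 131670 = 2·3²·5·7·11·19`; SPLIT MULTIPLICATIVE at `7` (Kodaira `I1`, `c_7 = 1`, additive at `3`); `#tors = 2`,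
`∏c = 32`, `r_an = 1`, `#Ш_an = 1`, generator `(9147/4, 868349/8)`; lane residue cell `(7, X11b)` (bsdN v4u/v5u of record: `residue:X3`, lane tail
T-BCS|open-ss, other open cells `(3, X3)`, `(5, X11b)`, `(11, X11b)`, `(19, X11b)`, `(tail, X7T)`); ALSO the unit's GEN 10 beyond-window DATA record
in `X11b/BeyondWindowRecords15.lean` (Skinner 2016 Thm. A ∘ Stein–Wuthrich 2013 `p`-adic road, binders as displayed there) — this row is a SECOND
road). `D = -5759` (5759 = 13·443): **`m = [E(K):ℤy_K] = 96`, `7 ∤ m`** (`ρ = 2304.00…`; `L'(E,1) = 11.20895874…`, `L(E^D,1) = 1.80466562…`,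
`ĥ(x) = 4.82718298…`) — engine 1 (j259809) = engine 2 (j260666; EQUAL, dev. ≤ 3.2·10⁻¹⁴, checks true); twist `E^D` (j260667):
`#tors·∏c·#Ш_an = 2·256·9`, prime to `7` — BSD-consistent. Witnesses mod `7` `(ℓ,#Ẽ(𝔽_ℓ))` = `(13,12)` (`a = 2`, `a² − 4ℓ ≡ 1` square), `(37,36)`
(`a = 2`, `a² − 4ℓ ≡ 3` non-square), `(13,12)` (`u ≡ 3`).
[cite: McCallumLMS1991, §1 Theorem (Kolyvagin), p. 296] [cite: Serre1972, §2.8 Prop. 19] [cite: Cremona2006, Table 1 (label 131670bj1)] -/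
theorem bsdp_k131670bj1_7 (hGZK : rank_eq_analyticRank_of_analyticRank_le_one) (W : WeierstrassCurve ℚ)
    (hW : W = ⟨1, -1, 1, 32917, 2063927⟩) {N : ℕ} [NeZero N] {K : Type} [Field K] [NumberField K]
    (hKo : kolyvagin N W K) (hB : Kolyvagin1990_padicValNat_card_sha_le N W K) (hK : IsImaginaryQuadratic K)
    (hH : SatisfiesHeegnerHypothesis N K) {P : (W.baseChange K).toAffine.Point} (hP : IsHeegnerPoint N W K P)
    (hnt : ¬ IsOfFinAddOrder P) (hI : ¬ 7 ∣ (AddSubgroup.zmultiples P).index) (hr : W.analyticRank ≤ 1)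
    {q : ℚ} (hq : shaAn W = (q : ℂ)) (hv : padicValRat 7 q = 0) : BSDp W 7 :=
  bsdp_prime_of_kolyvaginIndex_of_serreCounts 7 (by norm_num) (by norm_num) 1 (-1) 1 32917 2063927 (by decide +kernel)
    (by decide +kernel) (by decide +kernel) 13 37 13 (by norm_num) (by norm_num) (by norm_num) (by norm_num)
    (by norm_num) (by norm_num) (by norm_num) (by norm_num) (by norm_num) (by decide +kernel) (by decide +kernel)
    (by decide +kernel) (n₁ := 12) (n₂ := 36) (n₃ := 12) (hc₁ := by decide +kernel) (hc₂ := by decide +kernel)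
    (hc₃ := by decide +kernel) (by decide +kernel) (by decide +kernel) (by decide +kernel) hGZK W
    (by rw [hW]; norm_num) hKo hB hK hH hP hnt hI hr hq hv

/-- **`BSD(E,7)` for `131670z1`** (`N = 131670 = 2·3²·5·7·11·19`; NON-SPLIT MULTIPLICATIVE at `7` (Kodaira `I3`, `c_7 = 1`, additive at `3`);
`#tors = 1`, `∏c = 12`, `r_an = 1`, `#Ш_an = 1`, generator `(309, -146)`; lane residue cell `(7, X11b)` (bsdN v4u/v5u of record: `residue:X11b`,
lane tail T-KOLY); ALSO the unit's GEN 10 beyond-window DATA record in `X11b/BeyondWindowRecords15.lean` (Skinner 2016 Thm. A ∘ Stein–Wuthrich 2013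
`p`-adic road, binders as displayed there) — this row is a SECOND road). `D = -2351` (2351 prime): **`m = [E(K):ℤy_K] = 24`, `7 ∤ m`**
(`ρ = 144.00…`; `L'(E,1) = 11.78219926…`, `L(E^D,1) = 0.05109690…`, `ĥ(x) = 1.47405394…`) — engine 1 (j259809) = engine 2 (j260660; EQUAL, dev. ≤
5.8·10⁻¹³, checks true); twist `E^D` (j260667): `#tors·∏c·#Ш_an = 1·24·1`, prime to `7` — BSD-consistent. Witnesses mod `7` `(ℓ,#Ẽ(𝔽_ℓ))` =
`(29,36)` (`a = -6`, `a² − 4ℓ ≡ 4` square), `(13,13)` (`a = 1`, `a² − 4ℓ ≡ 5` non-square), `(13,13)` (`u ≡ 6`).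
[cite: McCallumLMS1991, §1 Theorem (Kolyvagin), p. 296] [cite: Serre1972, §2.8 Prop. 19] [cite: Cremona2006, Table 1 (label 131670z1)] -/
theorem bsdp_k131670z1_7 (hGZK : rank_eq_analyticRank_of_analyticRank_le_one) (W : WeierstrassCurve ℚ)
    (hW : W = ⟨1, -1, 1, -285917, 58916261⟩) {N : ℕ} [NeZero N] {K : Type} [Field K] [NumberField K]
    (hKo : kolyvagin N W K) (hB : Kolyvagin1990_padicValNat_card_sha_le N W K) (hK : IsImaginaryQuadratic K)
    (hH : SatisfiesHeegnerHypothesis N K) {P : (W.baseChange K).toAffine.Point} (hP : IsHeegnerPoint N W K P)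
    (hnt : ¬ IsOfFinAddOrder P) (hI : ¬ 7 ∣ (AddSubgroup.zmultiples P).index) (hr : W.analyticRank ≤ 1)
    {q : ℚ} (hq : shaAn W = (q : ℂ)) (hv : padicValRat 7 q = 0) : BSDp W 7 :=
  bsdp_prime_of_kolyvaginIndex_of_serreCounts 7 (by norm_num) (by norm_num) 1 (-1) 1 (-285917) 58916261 (by decide +kernel)
    (by decide +kernel) (by decide +kernel) 29 13 13 (by norm_num) (by norm_num) (by norm_num) (by norm_num)
    (by norm_num) (by norm_num) (by norm_num) (by norm_num) (by norm_num) (by decide +kernel) (by decide +kernel)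
    (by decide +kernel) (n₁ := 36) (n₂ := 13) (n₃ := 13) (hc₁ := by decide +kernel) (hc₂ := by decide +kernel)
    (hc₃ := by decide +kernel) (by decide +kernel) (by decide +kernel) (by decide +kernel) hGZK W
    (by rw [hW]; norm_num) hKo hB hK hH hP hnt hI hr hq hv

/-- **`BSD(E,7)` for `139230de1`** (`N = 139230 = 2·3²·5·7·13·17`; NON-SPLIT MULTIPLICATIVE at `7` (Kodaira `I1`, `c_7 = 1`, additive at `3`);
`#tors = 1`, `∏c = 4`, `r_an = 1`, `#Ш_an = 1`, generator `(106, 1067)`; lane residue cell `(7, X11b)` (bsdN v4u/v5u of record: `residue:X11b`, lane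
tail T-KOLY); ALSO the unit's GEN 10 beyond-window DATA record in `X11b/BeyondWindowRecords16.lean` (Skinner 2016 Thm. A ∘ Stein–Wuthrich 2013
`p`-adic road, binders as displayed there) — this row is a SECOND road). `D = -2831` (2831 = 19·149): **`m = [E(K):ℤy_K] = 24`, `7 ∤ m`**
(`ρ = 144.00…`; `L'(E,1) = 5.93527426…`, `L(E^D,1) = 0.70863738…`, `ĥ(x) = 1.94114825…`) — engine 1 (j259809) = engine 2 (j260660; EQUAL, dev. ≤
3.3·10⁻¹⁴, checks true); twist `E^D` (j260667): `#tors·∏c·#Ш_an = 1·8·9`, prime to `7` — BSD-consistent. Witnesses mod `7` `(ℓ,#Ẽ(𝔽_ℓ))` = `(19,19)`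
(`a = 1`, `a² − 4ℓ ≡ 2` square), `(11,11)` (`a = 1`, `a² − 4ℓ ≡ 6` non-square), `(19,19)` (`u ≡ 3`).
[cite: McCallumLMS1991, §1 Theorem (Kolyvagin), p. 296] [cite: Serre1972, §2.8 Prop. 19] [cite: Cremona2006, Table 1 (label 139230de1)] -/
theorem bsdp_k139230de1_7 (hGZK : rank_eq_analyticRank_of_analyticRank_le_one) (W : WeierstrassCurve ℚ)
    (hW : W = ⟨1, -1, 0, 531, 15525⟩) {N : ℕ} [NeZero N] {K : Type} [Field K] [NumberField K]
    (hKo : kolyvagin N W K) (hB : Kolyvagin1990_padicValNat_card_sha_le N W K) (hK : IsImaginaryQuadratic K)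
    (hH : SatisfiesHeegnerHypothesis N K) {P : (W.baseChange K).toAffine.Point} (hP : IsHeegnerPoint N W K P)
    (hnt : ¬ IsOfFinAddOrder P) (hI : ¬ 7 ∣ (AddSubgroup.zmultiples P).index) (hr : W.analyticRank ≤ 1)
    {q : ℚ} (hq : shaAn W = (q : ℂ)) (hv : padicValRat 7 q = 0) : BSDp W 7 :=
  bsdp_prime_of_kolyvaginIndex_of_serreCounts 7 (by norm_num) (by norm_num) 1 (-1) 0 531 15525 (by decide +kernel)
    (by decide +kernel) (by decide +kernel) 19 11 19 (by norm_num) (by norm_num) (by norm_num) (by norm_num)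
    (by norm_num) (by norm_num) (by norm_num) (by norm_num) (by norm_num) (by decide +kernel) (by decide +kernel)
    (by decide +kernel) (n₁ := 19) (n₂ := 11) (n₃ := 19) (hc₁ := by decide +kernel) (hc₂ := by decide +kernel)
    (hc₃ := by decide +kernel) (by decide +kernel) (by decide +kernel) (by decide +kernel) hGZK W
    (by rw [hW]; norm_num) hKo hB hK hH hP hnt hI hr hq hv

/-- **`BSD(E,7)` for `140910bf1`** (`N = 140910 = 2·3·5·7·11·61`; SPLIT MULTIPLICATIVE at `7` (Kodaira `I1`, `c_7 = 1`, semistable); `#tors = 2`,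
`∏c = 24`, `r_an = 1`, `#Ш_an = 1`, generator Cremona's (22-digit numerator); lane residue cell `(7, X11b)` (bsdN v4u/v5u of record: `residue:X11b`,
lane tail T-KOLY); ALSO the unit's GEN 10 beyond-window DATA record in `X11b/BeyondWindowRecords16.lean` (Skinner 2016 Thm. A ∘ Stein–Wuthrich 2013
`p`-adic road, binders as displayed there) — this row is a SECOND road). `D = -4919` (4919 prime): **`m = [E(K):ℤy_K] = 216`, `7 ∤ m`**
(`ρ = 11664.00…`; `L'(E,1) = 9.72969523…`, `L(E^D,1) = 0.62971255…`, `ĥ(x) = 46.21294816…`) — engine 1 (j259809) = engine 2 (j260662; EQUAL, dev. ≤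
2.4·10⁻¹³, checks true); twist `E^D` (j260667): `#tors·∏c·#Ш_an = 2·96·81`, prime to `7` — BSD-consistent. Witnesses mod `7` `(ℓ,#Ẽ(𝔽_ℓ))` =
`(41,40)` (`a = 2`, `a² − 4ℓ ≡ 1` square), `(13,10)` (`a = 4`, `a² − 4ℓ ≡ 6` non-square), `(13,10)` (`u ≡ 5`).
[cite: McCallumLMS1991, §1 Theorem (Kolyvagin), p. 296] [cite: Serre1972, §2.8 Prop. 19] [cite: Cremona2006, Table 1 (label 140910bf1)] -/
theorem bsdp_k140910bf1_7 (hGZK : rank_eq_analyticRank_of_analyticRank_le_one) (W : WeierstrassCurve ℚ)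
    (hW : W = ⟨1, 1, 1, -1978680066, 32124632353743⟩) {N : ℕ} [NeZero N] {K : Type} [Field K] [NumberField K]
    (hKo : kolyvagin N W K) (hB : Kolyvagin1990_padicValNat_card_sha_le N W K) (hK : IsImaginaryQuadratic K)
    (hH : SatisfiesHeegnerHypothesis N K) {P : (W.baseChange K).toAffine.Point} (hP : IsHeegnerPoint N W K P)
    (hnt : ¬ IsOfFinAddOrder P) (hI : ¬ 7 ∣ (AddSubgroup.zmultiples P).index) (hr : W.analyticRank ≤ 1)
    {q : ℚ} (hq : shaAn W = (q : ℂ)) (hv : padicValRat 7 q = 0) : BSDp W 7 :=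
  bsdp_prime_of_kolyvaginIndex_of_serreCounts 7 (by norm_num) (by norm_num) 1 1 1 (-1978680066) 32124632353743 (by decide +kernel)
    (by decide +kernel) (by decide +kernel) 41 13 13 (by norm_num) (by norm_num) (by norm_num) (by norm_num)
    (by norm_num) (by norm_num) (by norm_num) (by norm_num) (by norm_num) (by decide +kernel) (by decide +kernel)
    (by decide +kernel) (n₁ := 40) (n₂ := 10) (n₃ := 10) (hc₁ := by decide +kernel) (hc₂ := by decide +kernel)
    (hc₃ := by decide +kernel) (by decide +kernel) (by decide +kernel) (by decide +kernel) hGZK W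
    (by rw [hW]; norm_num) hKo hB hK hH hP hnt hI hr hq hv

/-- **`BSD(E,7)` for `149226bv1`** (`N = 149226 = 2·3·7·11·17·19`; NON-SPLIT MULTIPLICATIVE at `7` (Kodaira `I4`, `c_7 = 2`, semistable); `#tors = 1`,
`∏c = 8`, `r_an = 1`, `#Ш_an = 1`, generator `(6906/25, 840039/125)`; lane residue cell `(7, X11b)` (bsdN v4u/v5u of record: `residue:X11b`, lane
tail T-KOLY); ALSO the unit's GEN 10 beyond-window DATA record in `X11b/BeyondWindowRecords16.lean` (Skinner 2016 Thm. A ∘ Stein–Wuthrich 2013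
`p`-adic road, binders as displayed there) — this row is a SECOND road). `D = -2735` (2735 = 5·547): **`m = [E(K):ℤy_K] = 64`, `7 ∤ m`**
(`ρ = 1023.99…`; `L'(E,1) = 4.58241905…`, `L(E^D,1) = 0.49033689…`, `ĥ(x) = 2.51852212…`) — engine 1 (j259809) = engine 2 (j260664; EQUAL, dev. ≤
1.1·10⁻¹³, checks true); twist `E^D` (j260667): `#tors·∏c·#Ш_an = 1·16·16`, prime to `7` — BSD-consistent. Witnesses mod `7` `(ℓ,#Ẽ(𝔽_ℓ))` =
`(37,27)` (`a = 11`, `a² − 4ℓ ≡ 1` square), `(13,11)` (`a = 3`, `a² − 4ℓ ≡ 6` non-square), `(13,11)` (`u ≡ 5`).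
[cite: McCallumLMS1991, §1 Theorem (Kolyvagin), p. 296] [cite: Serre1972, §2.8 Prop. 19] [cite: Cremona2006, Table 1 (label 149226bv1)] -/
theorem bsdp_k149226bv1_7 (hGZK : rank_eq_analyticRank_of_analyticRank_le_one) (W : WeierstrassCurve ℚ)
    (hW : W = ⟨1, 1, 0, -261165, 98007453⟩) {N : ℕ} [NeZero N] {K : Type} [Field K] [NumberField K]
    (hKo : kolyvagin N W K) (hB : Kolyvagin1990_padicValNat_card_sha_le N W K) (hK : IsImaginaryQuadratic K)
    (hH : SatisfiesHeegnerHypothesis N K) {P : (W.baseChange K).toAffine.Point} (hP : IsHeegnerPoint N W K P)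
    (hnt : ¬ IsOfFinAddOrder P) (hI : ¬ 7 ∣ (AddSubgroup.zmultiples P).index) (hr : W.analyticRank ≤ 1)
    {q : ℚ} (hq : shaAn W = (q : ℂ)) (hv : padicValRat 7 q = 0) : BSDp W 7 :=
  bsdp_prime_of_kolyvaginIndex_of_serreCounts 7 (by norm_num) (by norm_num) 1 1 0 (-261165) 98007453 (by decide +kernel)
    (by decide +kernel) (by decide +kernel) 37 13 13 (by norm_num) (by norm_num) (by norm_num) (by norm_num)
    (by norm_num) (by norm_num) (by norm_num) (by norm_num) (by norm_num) (by decide +kernel) (by decide +kernel)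
    (by decide +kernel) (n₁ := 27) (n₂ := 11) (n₃ := 11) (hc₁ := by decide +kernel) (hc₂ := by decide +kernel)
    (hc₃ := by decide +kernel) (by decide +kernel) (by decide +kernel) (by decide +kernel) hGZK W
    (by rw [hW]; norm_num) hKo hB hK hH hP hnt hI hr hq hv

/-- **`BSD(E,7)` for `150150cg1`** (`N = 150150 = 2·3·5²·7·11·13`; SPLIT MULTIPLICATIVE at `7` (Kodaira `I1`, `c_7 = 1`, additive at `5`); `#tors = 1`,
`∏c = 6`, `r_an = 1`, `#Ш_an = 1`, generator `(-39, 188)`; lane residue cell `(7, X11b)` (bsdN v4u/v5u of record: `residue:X11b`, lane tail T-KOLY);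
ALSO the unit's GEN 10 beyond-window DATA record in `X11b/BeyondWindowRecords17.lean` (Skinner 2016 Thm. A ∘ Stein–Wuthrich 2013 `p`-adic road,
binders as displayed there) — this row is a SECOND road). `D = -2999` (2999 prime): **`m = [E(K):ℤy_K] = 48`, `7 ∤ m`** (`ρ = 575.99…`;
`L'(E,1) = 10.39336013…`, `L(E^D,1) = 1.32449531…`, `ĥ(x) = 1.13110714…`) — engine 1 (j259809) = engine 2 (j260664; EQUAL, dev. ≤ 7.1·10⁻¹⁴, checks
true); twist `E^D` (j260667): `#tors·∏c·#Ш_an = 1·12·16`, prime to `7` — BSD-consistent. Witnesses mod `7` `(ℓ,#Ẽ(𝔽_ℓ))` = `(19,12)` (`a = 8`,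
`a² − 4ℓ ≡ 2` square), `(17,20)` (`a = -2`, `a² − 4ℓ ≡ 6` non-square), `(17,20)` (`u ≡ 6`).
[cite: McCallumLMS1991, §1 Theorem (Kolyvagin), p. 296] [cite: Serre1972, §2.8 Prop. 19] [cite: Cremona2006, Table 1 (label 150150cg1)] -/
theorem bsdp_k150150cg1_7 (hGZK : rank_eq_analyticRank_of_analyticRank_le_one) (W : WeierstrassCurve ℚ)
    (hW : W = ⟨1, 1, 1, -1593, 23871⟩) {N : ℕ} [NeZero N] {K : Type} [Field K] [NumberField K]
    (hKo : kolyvagin N W K) (hB : Kolyvagin1990_padicValNat_card_sha_le N W K) (hK : IsImaginaryQuadratic K)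
    (hH : SatisfiesHeegnerHypothesis N K) {P : (W.baseChange K).toAffine.Point} (hP : IsHeegnerPoint N W K P)
    (hnt : ¬ IsOfFinAddOrder P) (hI : ¬ 7 ∣ (AddSubgroup.zmultiples P).index) (hr : W.analyticRank ≤ 1)
    {q : ℚ} (hq : shaAn W = (q : ℂ)) (hv : padicValRat 7 q = 0) : BSDp W 7 :=
  bsdp_prime_of_kolyvaginIndex_of_serreCounts 7 (by norm_num) (by norm_num) 1 1 1 (-1593) 23871 (by decide +kernel)
    (by decide +kernel) (by decide +kernel) 19 17 17 (by norm_num) (by norm_num) (by norm_num) (by norm_num)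
    (by norm_num) (by norm_num) (by norm_num) (by norm_num) (by norm_num) (by decide +kernel) (by decide +kernel)
    (by decide +kernel) (n₁ := 12) (n₂ := 20) (n₃ := 20) (hc₁ := by decide +kernel) (hc₂ := by decide +kernel)
    (hc₃ := by decide +kernel) (by decide +kernel) (by decide +kernel) (by decide +kernel) hGZK W
    (by rw [hW]; norm_num) hKo hB hK hH hP hnt hI hr hq hv

end Summit.BirchSwinnertonDyer.Rank1Residual.X11b

end
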